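import Summits.CriticalPhenomena.Ising3D.IsingColumnFaceL11CensusDistinctCoreLin
import Literature.Analysis.SpecialFunctions.LogTwoBounds

/-!
# The catalogue census of §7.3 as kernel facts, IX: the distinct-values machine, part 3 — the `TRG` tuple
generator (twenty-digit `log 2` / `e`), the tagged union, and the part check (cell `pub-ising3x`, seat recog-1;
paper §1.6 / §7.3)

HONEST FRAMING: lottery ticket; floor = tightest certified 3D Ising CFT bounds; no exact-solution
claim without a proof. Island framing: certified exclusion region at stated derivative order and
assumptions; not a determination of the 3D Ising critical exponents beyond that.

* `log2I20` / `eI20`: twenty-digit enclosures of `log 2` and `e` READ from the tree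
  (`Literature.Analysis.SpecialFunctions.Real.log_two_gt_d20 / _lt_d20`, `LogTwoBounds.lean`) and from Mathlib
  (`Real.exp_one_near_20`); `l5IT`, `trgLEnclT`, `trgGEnclT` = the landed `mulI`/`zpowI` composition of
  `ExclusionSentencesTrg` / `…TrgGamma` over the SAME landed intervals of `π, √π, √2, √3, ζ(3), ζ(5), G, Γ(¼), Γ(⅓)` with
  these two entries read finer, and `trgEnclNT` its outward rounding to naturals over `10¹⁸`. WHY a second `TRG`
  enclosure function: a distinctness statement is a precision statement, and at the landed ten-digit `log 2`
  (`Real.log_two_near_10`) / nine-digit `e` (`Real.exp_one_gt_d9`) exactly twelve consecutive pairs of the segment do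
  not separate (eight `TRG`–`TRG`, four `LIN`–`TRG`, each through a `log 2` or `e` factor; recog-1 gen 53
  `twin_landed.out`); no constant is certified anew;
* the `TRG` tuple generator `trgTupGen Wlo Whi` (canonical classes `trgGBList` × `u` × `a` × `trgLSList` of the census
  machine, lowest terms, `q` and `p` in the window ranges of the monomial enclosure — `ℕ` arithmetic in the shape of
  part VI's `trgWin`; the `LIN` = `TRG` form-coincidences `(p/q)·K` — sixteen on the segment — stay on THIS side and are
  dropped from the `LIN` side, `linIsTrg`), `trgEncOf`, SOUNDNESS (`trgTupGen_sound`) and COMPLETENESS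
  (`trgTupGen_complete`);
* the tagged union `Tup = LIN ⊕ TRG`, `encOf`, `valOf`, `TupOK`, `tupGen`, the three separation constants
  `dL / dT / dX` (units `distU`), the PART CHECK `distinctPart Wlo Whi` (sort the tagged enclosures of the part;
  `gapChain dL` on all, `gapChain dT` on the `TRG` subsequence, `crossChain dX`) and its meaning `distinctPart_sound`:
  any two distinct admissible tuples with scaled values in the part are separated by `dL`, by `dT` if both are
  `TRG`, by `dX` if of different tables.
Pure arithmetic over landed definitions and certified enclosures; no certificate, no datum, no σ–ε axiom; nothing is
recognised (§1.6); no P(M·) relevance. Python twin (same integers end to end): recog-1 gen 53 `twin.py` / `parts.py`.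
lottery ticket; floor = tightest certified 3D Ising CFT bounds; no exact-solution claim without a proof.
-/

namespace Summit.CriticalPhenomena.Ising3D
namespace ColumnFaceL11
open Set Literature.MathematicalPhysics.QuantumFieldTheory.ConformalBootstrap3D

/-! ### Twenty-digit `log 2` and `e` from the tree / Mathlib; the tight monomial enclosure -/

/-- `log 2 ∈ [0.69314718055994530940, 0.69314718055994530944]` (`LogTwoBounds.lean`). [folklore] -/
def log2I20 : ℚ × ℚ := (69314718055994530940 / 10 ^ 20, 69314718055994530944 / 10 ^ 20)

/-- Soundness of `log2I20`. [folklore] -/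
theorem log2_mem_log2I20 : Real.log 2 ∈ InI log2I20 := by
  have h1 := Literature.Analysis.SpecialFunctions.Real.log_two_gt_d20
  have h2 := Literature.Analysis.SpecialFunctions.Real.log_two_lt_d20
  refine ⟨?_, ?_⟩
  · simp only [log2I20]; push_cast; norm_num at h1 ⊢; linarith
  · simp only [log2I20]; push_cast; norm_num at h2 ⊢; linarith

/-- `e ∈ [363916618873/133877442384 − 10⁻²⁰, 363916618873/133877442384 + 10⁻²⁰]` (`Real.exp_one_near_20`). [folklore] -/
def eI20 : ℚ × ℚ := (363916618873 / 133877442384 - 1 / 10 ^ 20, 363916618873 / 133877442384 + 1 / 10 ^ 20)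

/-- Soundness of `eI20`. [folklore] -/
theorem e_mem_eI20 : Real.exp 1 ∈ InI eI20 := by
  have h := abs_le.mp Real.exp_one_near_20
  refine ⟨?_, ?_⟩
  · simp only [eI20]; push_cast; linarith [h.1]
  · simp only [eI20]; push_cast; linarith [h.2]

/-- Tight enclosure of `L` (index `0`: `log 2` — twenty digits; `2`: `ζ(3)`, `3`: `ζ(5)`, `4`: `G` — the landed
intervals; otherwise `e` — twenty digits). [folklore] -/
def l5IT : ℕ → ℚ × ℚ
  | 0 => log2I20
  | 1 => eI20
  | 2 => zeta3I
  | 3 => zeta5I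
  | 4 => catalanI
  | _ => eI20

/-- Soundness of `l5IT`, and positivity of both ends. [folklore] -/
theorem l5Val_memT (L : ℕ) : l5Val L ∈ InI (l5IT L) ∧ 0 < (l5IT L).1 ∧ 0 < (l5IT L).2 := by
  match L with
  | 0 => exact ⟨log2_mem_log2I20, by norm_num [l5IT, log2I20], by norm_num [l5IT, log2I20]⟩
  | 1 => exact ⟨e_mem_eI20, by norm_num [l5IT, eI20], by norm_num [l5IT, eI20]⟩
  | 2 => exact ⟨zeta3_mem_zeta3I, by norm_num [l5IT, zeta3I], by norm_num [l5IT, zeta3I]⟩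
  | 3 => exact ⟨zeta5_mem_zeta5I, by norm_num [l5IT, zeta5I], by norm_num [l5IT, zeta5I]⟩
  | 4 => exact ⟨catalan_mem_catalanI, by norm_num [l5IT, catalanI], by norm_num [l5IT, catalanI]⟩
  | n + 5 =>
      exact ⟨e_mem_eI20, by show (0 : ℚ) < eI20.1; norm_num [eI20], by show (0 : ℚ) < eI20.2; norm_num [eI20]⟩

/-- Tight enclosure of the monomial `u·(√π)^a·L^s` (the landed `trgLEncl` with `l5IT`). [folklore] -/
def trgLEnclT (u : ℕ) (a : ℤ) (L : ℕ) (s : ℤ) : ℚ × ℚ :=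
  mulI (mulI (uI u) (zpowI sqrtPiI a)) (zpowI (l5IT L) s)

/-- Soundness of `trgLEnclT`, and positivity of its lower end. [folklore] -/
theorem trgLVal_memT (u : ℕ) (a : ℤ) (L : ℕ) (s : ℤ) :
    trgLVal u a L s ∈ InI (trgLEnclT u a L s) ∧ 0 < (trgLEnclT u a L s).1 := by
  obtain ⟨hu, hu0⟩ := uVal_mem u
  obtain ⟨hl, hl1, hl2⟩ := l5Val_memT L
  have hsp : 0 < sqrtPiI.1 := by norm_num [sqrtPiI]
  have hsp2 : 0 < sqrtPiI.2 := by norm_num [sqrtPiI]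
  have h1 := zpowI_sound hsp sqrtPi_mem_sqrtPiI a
  have h1p := zpowI_pos hsp hsp2 a
  have h2 := zpowI_sound hl1 hl s
  have h2p := zpowI_pos hl1 hl2 s
  refine ⟨mulI_sound (by simp only [mulI]; positivity) h2p.le (mulI_sound hu0.le h1p.le hu h1) h2, ?_⟩
  simp only [trgLEnclT, mulI]
  positivity

/-- Tight enclosure of the full monomial `u·(√π)^a·L^s·Γ_g^b` (the landed `trgGEncl` with `trgLEnclT`). [folklore] -/
def trgGEnclT (u : ℕ) (a : ℤ) (g : ℕ) (b : ℤ) (L : ℕ) (s : ℤ) : ℚ × ℚ :=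
  mulI (trgLEnclT u a L s) (zpowI (gamI g) b)

/-- Soundness of `trgGEnclT`, and positivity of its lower end. [folklore] -/
theorem trgGVal_memT (u : ℕ) (a : ℤ) (g : ℕ) (b : ℤ) (L : ℕ) (s : ℤ) :
    trgGVal u a g b L s ∈ InI (trgGEnclT u a g b L s) ∧ 0 < (trgGEnclT u a g b L s).1 := by
  obtain ⟨hm, hm0⟩ := trgLVal_memT u a L s
  obtain ⟨hg, hg1, hg2⟩ := gamVal_mem g
  have h2 := zpowI_sound hg1 hg b
  have h2p := zpowI_pos hg1 hg2 b
  refine ⟨mulI_sound hm0.le h2p.le hm h2, ?_⟩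
  simp only [trgGEnclT, mulI]
  exact mul_pos hm0 h2p

/-- Outward natural-number enclosure (numerators over `10¹⁸`) of the monomial from `trgGEnclT`. [folklore] -/
def trgEnclNT (u : ℕ) (a : ℤ) (g : ℕ) (b : ℤ) (L : ℕ) (s : ℤ) : ℕ × ℕ :=
  ((⌊(trgGEnclT u a g b L s).1 * 10 ^ 18⌋).toNat, (⌈(trgGEnclT u a g b L s).2 * 10 ^ 18⌉).toNat)

/-- Soundness of `trgEnclNT`: `M₁ ≤ 10¹⁸·(u·π^{a/2}·Γ_g^b·L^s) ≤ M₂`, and `1 ≤ M₂`. [folklore] -/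
theorem trgEnclNT_sound (u : ℕ) (a : ℤ) (g : ℕ) (b : ℤ) (L : ℕ) (s : ℤ) :
    (((trgEnclNT u a g b L s).1 : ℕ) : ℝ) ≤ 10 ^ 18 * trgGVal u a g b L s ∧
      (10 : ℝ) ^ 18 * trgGVal u a g b L s ≤ (((trgEnclNT u a g b L s).2 : ℕ) : ℝ) ∧
      1 ≤ (trgEnclNT u a g b L s).2 := by
  obtain ⟨⟨hm1, hm2⟩, hm0⟩ := trgGVal_memT u a g b L s
  set m := trgGEnclT u a g b L s with hm
  have hm12 : m.1 ≤ m.2 := by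
    have : (m.1 : ℝ) ≤ m.2 := hm1.trans hm2
    exact_mod_cast this
  have hf0 : 0 ≤ ⌊m.1 * 10 ^ 18⌋ := Int.floor_nonneg.mpr (by positivity)
  have hc1 : 1 ≤ ⌈m.2 * 10 ^ 18⌉ := by
    have h18 : (0 : ℚ) < m.2 * 10 ^ 18 := by nlinarith
    have : (0 : ℤ) < ⌈m.2 * 10 ^ 18⌉ := Int.ceil_pos.mpr h18
    omega
  have hc0 : 0 ≤ ⌈m.2 * 10 ^ 18⌉ := by omega
  have e1 : ((⌊m.1 * 10 ^ 18⌋ : ℤ) : ℚ) ≤ m.1 * 10 ^ 18 := Int.floor_le _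
  have e2 : m.2 * 10 ^ 18 ≤ ((⌈m.2 * 10 ^ 18⌉ : ℤ) : ℚ) := Int.le_ceil _
  have e1' : (((⌊m.1 * 10 ^ 18⌋ : ℤ) : ℚ) : ℝ) ≤ ((m.1 * 10 ^ 18 : ℚ) : ℝ) := Rat.cast_le.mpr e1
  have e2' : ((m.2 * 10 ^ 18 : ℚ) : ℝ) ≤ (((⌈m.2 * 10 ^ 18⌉ : ℤ) : ℚ) : ℝ) := Rat.cast_le.mpr e2
  push_cast at e1' e2'
  have c1 : (((⌊m.1 * 10 ^ 18⌋).toNat : ℕ) : ℝ) = ((⌊m.1 * 10 ^ 18⌋ : ℤ) : ℝ) := by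
    have h := Int.toNat_of_nonneg hf0
    exact_mod_cast h
  have c2 : (((⌈m.2 * 10 ^ 18⌉).toNat : ℕ) : ℝ) = ((⌈m.2 * 10 ^ 18⌉ : ℤ) : ℝ) := by
    have h := Int.toNat_of_nonneg hc0
    exact_mod_cast h
  have c2n : 1 ≤ (⌈m.2 * 10 ^ 18⌉).toNat := by
    have h := Int.toNat_of_nonneg hc0
    omega
  simp only [trgEnclNT]
  rw [c1, c2]
  refine ⟨by nlinarith, by nlinarith, c2n⟩

/-! ### The `TRG` enclosure of a tuple -/

/-- The tagged scaled enclosure of a `TRG` tuple: `(p·M₁·(lcm32/q), p·M₂·(lcm32/q), 1)` with `M = trgEnclNT` of its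
monomial. [folklore] -/
def trgEncOf (e : TrgTuple) : Enc :=
  match e with
  | (p, q, u, a, g, b, L, s) =>
    (p * ((trgEnclNT u a g b L s).1 * (lcm32 / q)), p * ((trgEnclNT u a g b L s).2 * (lcm32 / q)), 1)

/-- The scaled value of a `TRG` tuple: `distU · (p/q)·V = p·(lcm32/q)·(10¹⁸ V)`. [folklore] -/
theorem distU_mul_trgVal (p : ℕ) {q : ℕ} (hq1 : 1 ≤ q) (hq2 : q ≤ 32) (u : ℕ) (a : ℤ) (g : ℕ) (b : ℤ)
    (L : ℕ) (s : ℤ) :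
    (distU : ℝ) * trgGTupleVal (p, q, u, a, g, b, L, s) =
      (p : ℝ) * ((lcm32 / q : ℕ) : ℝ) * ((10 : ℝ) ^ 18 * trgGVal u a g b L s) := by
  set f : ℕ := lcm32 / q with hf
  have hfq : f * q = lcm32 := Nat.div_mul_cancel (dvd_lcm32 hq1 hq2)
  have hfq' : (f : ℝ) * (q : ℝ) = (lcm32 : ℝ) := by exact_mod_cast hfq
  have hq0 : (0 : ℝ) < q := by exact_mod_cast hq1
  have e : (distU : ℝ) = (10 : ℝ) ^ 18 * ((f : ℝ) * (q : ℝ)) := by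
    rw [hfq']; unfold distU linS; push_cast; ring
  unfold trgGTupleVal
  simp only
  calc (distU : ℝ) * ((p : ℝ) / q * trgGVal u a g b L s)
      = (10 : ℝ) ^ 18 * ((f : ℝ) * (q : ℝ)) * ((p : ℝ) / q * trgGVal u a g b L s) := by rw [e]
    _ = (p : ℝ) * (f : ℝ) * ((10 : ℝ) ^ 18 * trgGVal u a g b L s) * ((q : ℝ) / (q : ℝ)) := by ring
    _ = (p : ℝ) * (f : ℝ) * ((10 : ℝ) ^ 18 * trgGVal u a g b L s) := by rw [div_self hq0.ne', mul_one]

/-- **Soundness of `trgEncOf`**: for `1 ≤ q ≤ 32` the enclosure contains `distU · value`. [folklore] -/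
theorem trgEncOf_sound (p : ℕ) {q : ℕ} (hq1 : 1 ≤ q) (hq2 : q ≤ 32) (u : ℕ) (a : ℤ) (g : ℕ) (b : ℤ)
    (L : ℕ) (s : ℤ) :
    (((trgEncOf (p, q, u, a, g, b, L, s)).1 : ℕ) : ℝ) ≤ (distU : ℝ) * trgGTupleVal (p, q, u, a, g, b, L, s) ∧
      (distU : ℝ) * trgGTupleVal (p, q, u, a, g, b, L, s) ≤
        (((trgEncOf (p, q, u, a, g, b, L, s)).2.1 : ℕ) : ℝ) := by
  obtain ⟨hM1, hM2, -⟩ := trgEnclNT_sound u a g b L s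
  rw [distU_mul_trgVal p hq1 hq2]
  have hpf : (0 : ℝ) ≤ (p : ℝ) * ((lcm32 / q : ℕ) : ℝ) := by positivity
  unfold trgEncOf
  simp only
  push_cast
  constructor
  · nlinarith [mul_le_mul_of_nonneg_left hM1 hpf]
  · nlinarith [mul_le_mul_of_nonneg_left hM2 hpf]

/-! ### The `TRG` generator on a scaled window (tuples WITH their enclosures), soundness, completeness -/

/-- Window candidates of one canonical monomial `(u, a, g, b, L, s)` with natural enclosure `M`: the denominators
`q ∈ [max 1 ⌈M₁·lcm32/Whi⌉, min 32 ⌊32·M₂·lcm32/Wlo⌋]` (outside this range no `p ∈ [1, 32]` can put the value in the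
window — most monomials cost one step), `f = lcm32/q`, `A = M₁f`, `B = M₂f`, `p ∈ [max 1 ⌈Wlo/B⌉, min 32 ⌊Whi/A⌋]` (`32` if
`M₁ = 0`), lowest terms; each emitted WITH its tagged enclosure `(pA, pB, 1)` (`= trgEncOf`, `trgGen_snd`). [folklore] -/
def trgGenM (Wlo Whi : ℕ) (u : ℕ) (a : ℤ) (g : ℕ) (b : ℤ) (L : ℕ) (s : ℤ) (M : ℕ × ℕ) : List (TrgTuple × Enc) :=
  let qlo := max 1 ((M.1 * lcm32 + Whi - 1) / Whi)
  let qhi := min 32 (32 * M.2 * lcm32 / Wlo)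
  (List.range' qlo (qhi + 1 - qlo)).flatMap fun q : ℕ =>
    let A := M.1 * (lcm32 / q)
    let B := M.2 * (lcm32 / q)
    let plo := max 1 ((Wlo + B - 1) / B)
    let phi := if M.1 = 0 then 32 else min 32 (Whi / A)
    (List.range' plo (phi + 1 - plo)).flatMap fun p : ℕ =>
      if Nat.gcd p q = 1 then [((p, q, u, a, g, b, L, s), (p * A, p * B, 1))] else []

/-- **The `TRG` generator** on the scaled window `[Wlo, Whi]` (tuples with enclosures): the fifteen `Γ`-classes
`trgGBList`, `u ≤ 2`, `a ∈ [−6, 6]`, the eleven `(L, s)` classes `trgLSList` of the census machine (the empty exponent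
triple skipped), each monomial through `trgGenM` with its tight natural enclosure `trgEnclNT`. [folklore] -/
def trgGen (Wlo Whi : ℕ) : List (TrgTuple × Enc) :=
  trgGBList.flatMap fun gb => (List.range 3).flatMap fun u => (iccList (-6) 6).flatMap fun a =>
    trgLSList.flatMap fun Ls =>
      if a = 0 ∧ gb.2 = 0 ∧ Ls.2 = 0 then [] else
        trgGenM Wlo Whi u a gb.1 gb.2 Ls.1 Ls.2 (trgEnclNT u a gb.1 gb.2 Ls.1 Ls.2)

/-- The `TRG` tuples of the window. [folklore] -/
def trgTupGen (Wlo Whi : ℕ) : List TrgTuple := (trgGen Wlo Whi).map Prod.fst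

/-- What `trgGenM` lists. [folklore] -/
theorem mem_trgGenM_iff {Wlo Whi : ℕ} {u : ℕ} {a : ℤ} {g : ℕ} {b : ℤ} {L : ℕ} {s : ℤ} {M : ℕ × ℕ}
    {x : TrgTuple × Enc} : x ∈ trgGenM Wlo Whi u a g b L s M ↔ ∃ q p : ℕ,
      (max 1 ((M.1 * lcm32 + Whi - 1) / Whi) ≤ q ∧ q ≤ min 32 (32 * M.2 * lcm32 / Wlo)) ∧
      (max 1 ((Wlo + M.2 * (lcm32 / q) - 1) / (M.2 * (lcm32 / q))) ≤ p ∧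
        p ≤ (if M.1 = 0 then 32 else min 32 (Whi / (M.1 * (lcm32 / q))))) ∧
      Nat.gcd p q = 1 ∧
      x = ((p, q, u, a, g, b, L, s), (p * (M.1 * (lcm32 / q)), p * (M.2 * (lcm32 / q)), 1)) := by
  unfold trgGenM
  simp only [List.mem_flatMap, List.mem_range'_1]
  constructor
  · rintro ⟨q, hq, p, hp, hx⟩
    by_cases hc : Nat.gcd p q = 1
    · rw [if_pos hc, List.mem_singleton] at hx
      exact ⟨q, p, by omega, by omega, hc, hx⟩
    · rw [if_neg hc] at hx; simp at hx
  · rintro ⟨q, p, hq, hp, hg1, rfl⟩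
    refine ⟨q, by omega, p, by omega, ?_⟩
    rw [if_pos hg1, List.mem_singleton]

/-- What `trgGen` lists. [folklore] -/
theorem mem_trgGen_iff {Wlo Whi : ℕ} {x : TrgTuple × Enc} : x ∈ trgGen Wlo Whi ↔
    ∃ (g : ℕ) (b : ℤ) (u : ℕ) (a : ℤ) (L : ℕ) (s : ℤ), (g, b) ∈ trgGBList ∧ u < 3 ∧ (-6 ≤ a ∧ a ≤ 6) ∧
      (L, s) ∈ trgLSList ∧ ¬(a = 0 ∧ b = 0 ∧ s = 0) ∧
      x ∈ trgGenM Wlo Whi u a g b L s (trgEnclNT u a g b L s) := by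
  unfold trgGen
  simp only [List.mem_flatMap, List.mem_range, mem_iccList]
  constructor
  · rintro ⟨⟨g, b⟩, hgb, u, hu, a, ha, ⟨L, s⟩, hLs, hx⟩
    simp only at hx
    split_ifs at hx with h0
    · simp at hx
    · exact ⟨g, b, u, a, L, s, hgb, hu, ha, hLs, h0, hx⟩
  · rintro ⟨g, b, u, a, L, s, hgb, hu, ha, hLs, h0, hx⟩
    refine ⟨(g, b), hgb, u, hu, a, ha, (L, s), hLs, ?_⟩
    simp only
    rw [if_neg h0]
    exact hx

/-- The emitted enclosure IS `trgEncOf` of the emitted tuple. [folklore] -/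
theorem trgGen_snd {Wlo Whi : ℕ} {x : TrgTuple × Enc} (hx : x ∈ trgGen Wlo Whi) : x.2 = trgEncOf x.1 := by
  obtain ⟨g, b, u, a, L, s, -, -, -, -, -, hx⟩ := mem_trgGen_iff.mp hx
  obtain ⟨q, p, -, -, -, rfl⟩ := mem_trgGenM_iff.mp hx
  rfl

/-- The emitted enclosures are `trgEncOf` of the tuples (as lists). [folklore] -/
theorem trgGen_map_snd (Wlo Whi : ℕ) : (trgGen Wlo Whi).map Prod.snd = (trgTupGen Wlo Whi).map trgEncOf := by
  unfold trgTupGen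
  rw [List.map_map]
  exact List.map_congr_left fun x hx => trgGen_snd hx

/-- **Soundness of the `TRG` generator**: a generated tuple is a canonical lowest-terms tuple of the table
`trgFullFamily 17 32`, and its enclosure contains `distU · value`. [folklore] -/
theorem trgTupGen_sound {Wlo Whi : ℕ} {e : TrgTuple} (he : e ∈ trgTupGen Wlo Whi) :
    trgGTupleOK 17 32 e = true ∧ trgCanon e = true ∧ trgPrim e = true ∧
      (((trgEncOf e).1 : ℕ) : ℝ) ≤ (distU : ℝ) * trgGTupleVal e ∧
        (distU : ℝ) * trgGTupleVal e ≤ (((trgEncOf e).2.1 : ℕ) : ℝ) := by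
  unfold trgTupGen at he
  rw [List.mem_map] at he
  obtain ⟨x, hx, rfl⟩ := he
  obtain ⟨g, b, u, a, L, s, hgb, hu, ha, hLs, h0, hx⟩ := mem_trgGen_iff.mp hx
  obtain ⟨hg, hb1, hb2, hgb0⟩ := mem_trgGBList_iff.mp hgb
  obtain ⟨hL, hs1, hs2, hLs0⟩ := mem_trgLSList_iff.mp hLs
  obtain ⟨q, p, hq', hp, hgcd, rfl⟩ := mem_trgGenM_iff.mp hx
  set M := trgEnclNT u a g b L s with hM
  have hq : 1 ≤ q ∧ q ≤ 32 :=
    ⟨le_trans (Nat.le_max_left _ _) hq'.1, le_trans hq'.2 (Nat.min_le_left _ _)⟩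
  have hp1 : 1 ≤ p := le_trans (Nat.le_max_left _ _) hp.1
  have hp32 : p ≤ 32 := by
    have h := hp.2
    split_ifs at h with hz
    · exact h
    · exact le_trans h (Nat.min_le_left _ _)
  have hok : trgGTupleOK 17 32 (p, q, u, a, g, b, L, s) = true := by
    simp only [trgGTupleOK, Bool.and_eq_true, decide_eq_true_eq]
    refine ⟨⟨⟨⟨⟨⟨⟨⟨⟨⟨⟨⟨⟨⟨hp1, hp32⟩, hq.1⟩, hq.2⟩, by omega⟩, hL⟩, hg⟩, ha.1⟩, ha.2⟩, hb1⟩, hb2⟩, hs1⟩, hs2⟩,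
      by omega⟩, ?_⟩
    have h1 : a.natAbs ≤ 6 := by omega
    have h2 : b.natAbs ≤ 4 := by omega
    have h3 : s.natAbs ≤ 1 := by omega
    split_ifs <;> omega
  have hcan : trgCanon (p, q, u, a, g, b, L, s) = true := by
    simp only [trgCanon, Bool.and_eq_true, Bool.not_eq_true', decide_eq_false_iff_not]
    exact ⟨hLs0, hgb0⟩
  have hprim : trgPrim (p, q, u, a, g, b, L, s) = true := by
    simp only [trgPrim, beq_iff_eq]; exact hgcd
  exact ⟨hok, hcan, hprim, trgEncOf_sound p hq.1 hq.2 u a g b L s⟩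

/-- **Completeness of the `TRG` generator**: on a window with `Wlo > 0`, every canonical lowest-terms tuple of the table
`trgFullFamily 17 32` that whose scaled value lies in `[Wlo, Whi]` is generated. [folklore] -/
theorem trgTupGen_complete {Wlo Whi : ℕ} (hW : 0 < Wlo) {e : TrgTuple} (hok : trgGTupleOK 17 32 e = true)
    (hcan : trgCanon e = true) (hprim : trgPrim e = true)
    (hlo : (Wlo : ℝ) ≤ (distU : ℝ) * trgGTupleVal e) (hhi : (distU : ℝ) * trgGTupleVal e ≤ (Whi : ℝ)) :
    e ∈ trgTupGen Wlo Whi := by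
  have hWW : Wlo ≤ Whi := by exact_mod_cast hlo.trans hhi
  have hWhi : 0 < Whi := lt_of_lt_of_le hW hWW
  obtain ⟨p, q, u, a, g, b, L, s⟩ := e
  have hok' := hok
  simp only [trgGTupleOK, Bool.and_eq_true, decide_eq_true_eq] at hok'
  obtain ⟨⟨⟨⟨⟨⟨⟨⟨⟨⟨⟨⟨⟨⟨hp1, hph⟩, hq1⟩, hqh⟩, hu⟩, hL⟩, hg⟩, ha1⟩, ha2⟩, hb1⟩, hb2⟩, hs1⟩, hs2⟩,
    hne⟩, -⟩ := hok'
  simp only [trgCanon, Bool.and_eq_true, Bool.not_eq_true', decide_eq_false_iff_not] at hcan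
  simp only [trgPrim, beq_iff_eq] at hprim
  obtain ⟨hM1, hM2, hM2pos⟩ := trgEnclNT_sound u a g b L s
  set M := trgEnclNT u a g b L s with hM
  set f : ℕ := lcm32 / q with hf
  have hfq : f * q = lcm32 := Nat.div_mul_cancel (dvd_lcm32 hq1 hqh)
  have hf1 : 1 ≤ f := by
    rcases Nat.eq_zero_or_pos f with h0 | h0
    · rw [h0, zero_mul] at hfq; unfold lcm32 at hfq; omega
    · exact h0
  rw [distU_mul_trgVal p hq1 hqh] at hlo hhi
  have hpf : (0 : ℝ) ≤ (p : ℝ) * (f : ℝ) := by positivity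
  -- integer inequalities: Wlo ≤ p·(M₂ f), p·(M₁ f) ≤ Whi
  have n1 : Wlo ≤ (M.2 * f) * p := by
    have h : (Wlo : ℝ) ≤ (p : ℝ) * (f : ℝ) * (M.2 : ℝ) :=
      hlo.trans (by nlinarith [mul_le_mul_of_nonneg_left hM2 hpf])
    have h' : (Wlo : ℝ) ≤ ((M.2 * f * p : ℕ) : ℝ) := by push_cast; linarith
    exact_mod_cast h'
  have n2 : p * (M.1 * f) ≤ Whi := by
    have h : (p : ℝ) * (f : ℝ) * (M.1 : ℝ) ≤ (Whi : ℝ) :=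
      le_trans (by nlinarith [mul_le_mul_of_nonneg_left hM1 hpf]) hhi
    have h' : ((p * (M.1 * f) : ℕ) : ℝ) ≤ (Whi : ℝ) := by push_cast; linarith
    exact_mod_cast h'
  have hMf : 0 < M.2 * f := Nat.mul_pos (by omega) (by omega)
  unfold trgTupGen
  rw [List.mem_map]
  refine ⟨_, mem_trgGen_iff.mpr ⟨g, b, u, a, L, s, mem_trgGBList_iff.mpr ⟨hg, hb1, hb2, hcan.2⟩, by omega,
    ⟨ha1, ha2⟩, mem_trgLSList_iff.mpr ⟨hL, hs1, hs2, hcan.1⟩, by omega,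
    mem_trgGenM_iff.mpr ⟨q, p, ⟨?_, ?_⟩, ⟨?_, ?_⟩, hprim, rfl⟩⟩, rfl⟩
  · -- lower end of the q range: M₁·lcm32 ≤ Whi·q
    rw [← hM]
    refine max_le hq1 (ceilDiv_le_of_le_mul hWhi ?_)
    have h1 : M.1 * f ≤ p * (M.1 * f) := Nat.le_mul_of_pos_left _ (by omega)
    have h2 : M.1 * lcm32 = M.1 * f * q := by rw [← hfq]; ring
    rw [h2]
    calc M.1 * f * q ≤ p * (M.1 * f) * q := Nat.mul_le_mul_right _ h1
      _ ≤ Whi * q := Nat.mul_le_mul_right _ n2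
  · -- upper end of the q range: q·Wlo ≤ 32·M₂·lcm32
    rw [← hM]
    refine le_min hqh ((Nat.le_div_iff_mul_le hW).mpr ?_)
    have h32 : (M.2 * f) * p ≤ (M.2 * f) * 32 := Nat.mul_le_mul_left _ hph
    have h2 : 32 * M.2 * lcm32 = (M.2 * f) * 32 * q := by rw [← hfq]; ring
    rw [h2]
    calc q * Wlo ≤ q * ((M.2 * f) * 32) := Nat.mul_le_mul_left _ (n1.trans h32)
      _ = (M.2 * f) * 32 * q := by ring
  · -- lower end of the p range
    rw [← hf]
    refine max_le hp1 (ceilDiv_le_of_le_mul hMf n1)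
  · -- upper end of the p range
    rw [← hf]
    split_ifs with hz
    · exact hph
    · refine le_min hph ?_
      have hz' : 0 < M.1 := by rw [hM]; exact Nat.pos_of_ne_zero hz
      have hM1f : 0 < M.1 * f := Nat.mul_pos hz' (by omega)
      exact (Nat.le_div_iff_mul_le hM1f).mpr n2

end ColumnFaceL11
end Summit.CriticalPhenomena.Ising3D
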